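import Summits.BirchSwinnertonDyer.BirchSwinnertonDyer.Theorems.LeadingTermPinchPrimeOrderEqRankOfSchneiderShaAt
import Literature.NumberTheory.EllipticCurves.MordellWeilTheoremProofs
import Literature.NumberTheory.EllipticCurves.PAdicHeightsRegulatorProofs

/-!
# BirchSwinnertonDyer / LeadingTerm — crux `PinchPrime` (stmt-BirchSwinnertonDyer-16218),
# line `SketchIdeator2`, stub `stub_schneider_of_hasCM_of_rank_le_one` (G8, KNOWN SLICE:
# CM curves of Mordell–Weil rank `≤ 1`)

Registered stub (G8) of the lead skeleton `Cruxes/PinchPrime/Lines/SketchIdeator2.lean` (v12). The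
crux `LeadingTerm.PinchPrime` asks, for every elliptic `E/ℚ` (globally minimal `W`), for ONE good
ordinary prime `p ≥ 5` at which `ord_{T=0} L_p = rank_ℤ E(ℚ)`; the line's open height-side stub is
Schneider non-degeneracy `Reg_p(E, Dh) ≠ 0` (`WeierstrassCurve.SchneiderConjecture Dh`) of the
canonical cyclotomic `p`-adic height at good ordinary primes. This file proves the KNOWN CM SLICE of
that statement: for a CM curve `E/ℚ` of Mordell–Weil rank `≤ 1`, Schneider's conjecture holds for
every canonical height datum `Dh` at EVERY good ordinary prime `p ≥ 5`, GIVEN Bertrand's theorem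
as an explicit hypothesis (Bertrand, Noordwijkerhout 1983, LNM 1068 (1984), §3 Corollaire 1: on a
CM curve the canonical `p`-adic height `⟨P, P⟩_p` of a non-torsion point `P ∈ E(ℚ)` is non-zero at
every good ordinary `p`; here quantified over `p ≥ 5` and canonical data `D`).

Proof (pure Mordell–Weil-basis / determinant bookkeeping; the regulator is the Gram determinant of
the height pairing on a Mordell–Weil basis, Mazur–Tate–Teitelbaum 1986, §II.4). Take a Mordell–Weil
basis `B : Fin r → E(ℚ)`, `r = rank_ℤ E(ℚ)` (`WeierstrassCurve.exists_isMordellWeilBasis_holds`,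
PROVED); the regulator is basis independent
(`WeierstrassCurve.IsMordellWeilBasis.padicRegulatorOf_eq_padicRegulator`, PROVED), so
`Reg_p(E, Dh) = det (⟨Bᵢ, Bⱼ⟩_Dh)`. If `r = 0` the Gram matrix is empty and `Reg_p = 1 ≠ 0`
(`Matrix.det_isEmpty`). If `r = 1` then `Reg_p = ⟨B₀, B₀⟩_Dh` (`Matrix.det_eq_elem_of_card_eq_one`),
and `B₀` is non-torsion because its class in `E(ℚ)/E(ℚ)_tors` is a member of a `ℤ`-linearly
independent family, hence non-zero (`LinearIndependent.ne_zero`, `QuotientAddGroup.eq_zero_iff`,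
`AddCommGroup.mem_torsion`); Bertrand's hypothesis gives `⟨B₀, B₀⟩_Dh ≠ 0`.
-/

noncomputable section

set_option linter.dupNamespace false

namespace Summit.BirchSwinnertonDyer.BirchSwinnertonDyer.Cruxes.PinchPrime.FirstLayerStability

open scoped MatrixGroups ModularForm
open CongruenceSubgroup Literature.NumberTheory.EllipticCurves
  Literature.NumberTheory.EllipticCurves.ModularForms
open Summit.BirchSwinnertonDyer.BirchSwinnertonDyer.Theses

/-- **Schneider's conjecture for CM curves of rank `≤ 1`, from Bertrand's theorem** (stub
`stub_schneider_of_hasCM_of_rank_le_one` (G8) of crux `PinchPrime`, line `SketchIdeator2`).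
Assume Bertrand's theorem (hypothesis): for every CM elliptic curve `E/ℚ` (globally minimal `W`),
every good ordinary prime `p ≥ 5`, every canonical `p`-adic height datum `D` and every non-torsion
`P ∈ E(ℚ)`, `⟨P, P⟩_D ≠ 0` (Bertrand 1984, §3 Corollaire 1). Then for every CM curve `E/ℚ` with
`rank_ℤ E(ℚ) ≤ 1`, every good ordinary `p ≥ 5` and every canonical datum `Dh`,
`Reg_p(E, Dh) ≠ 0` (`WeierstrassCurve.SchneiderConjecture Dh`): on a Mordell–Weil basis
`B : Fin r → E(ℚ)` the regulator is the Gram determinant `det (⟨Bᵢ, Bⱼ⟩_Dh)` (MTT 1986, §II.4;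
basis independence `IsMordellWeilBasis.padicRegulatorOf_eq_padicRegulator`), which is `1` for
`r = 0` and `⟨B₀, B₀⟩_Dh` for `r = 1`, where `B₀` is non-torsion (its class in `E(ℚ)/tors` lies in
a `ℤ`-linearly independent family), so Bertrand's hypothesis applies.
[cite: Bertrand1984ThetaCM, §3 Corollaire 1] [cite: MazurTateTeitelbaum1986Invent, §II.4] -/
theorem stub_schneider_of_hasCM_of_rank_le_one :
    (∀ (W : WeierstrassCurve ℚ) [W.IsElliptic] [W.IsGloballyMinimal], W.HasCM →
      ∀ (p : ℕ) [Fact p.Prime], 5 ≤ p → W.HasGoodReductionAtPrime p →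
        ¬ (p : ℤ) ∣ W.frobeniusTrace p →
        ∀ (D : WeierstrassCurve.PAdicHeightData W p), D.IsCanonical →
          ∀ (P : W.toAffine.Point), ¬ IsOfFinAddOrder P → D.pairing P P ≠ 0) →
    ∀ (W : WeierstrassCurve ℚ) [W.IsElliptic] [W.IsGloballyMinimal], W.HasCM →
      W.mordellWeilRank ≤ 1 →
      ∀ (p : ℕ) [Fact p.Prime], 5 ≤ p → IsOrdinaryAt W p →
        ∀ Dh : WeierstrassCurve.PAdicHeightData W p, Dh.IsCanonical →
          WeierstrassCurve.SchneiderConjecture Dh := by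
  intro hBer W _ _ hCM hrk p _ h5 hord Dh hDh
  -- a Mordell–Weil basis `B : Fin r → E(ℚ)`, `r = rank_ℤ E(ℚ)`; `Reg_p = det (⟨Bᵢ, Bⱼ⟩_Dh)`
  obtain ⟨B, hB⟩ := W.exists_isMordellWeilBasis_holds
  unfold WeierstrassCurve.SchneiderConjecture
  rw [← hB.padicRegulatorOf_eq_padicRegulator Dh, WeierstrassCurve.padicRegulatorOf]
  rcases Nat.le_one_iff_eq_zero_or_eq_one.mp hrk with h0 | h1
  · -- rank `0`: the empty Gram determinant is `1`
    haveI : IsEmpty (Fin W.mordellWeilRank) := by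
      rw [h0]
      infer_instance
    refine ne_of_eq_of_ne (b := (1 : ℚ_[p])) ?_ one_ne_zero
    -- (`convert`: the `DecidableEq (Fin r)` instance inside `padicRegulatorOf` is the classical one)
    convert Matrix.det_isEmpty (A := Dh.pairingMatrix B)
  · -- rank `1`: the `1 × 1` Gram determinant is `⟨B k, B k⟩_Dh` for the unique index `k`
    have hcard : Fintype.card (Fin W.mordellWeilRank) = 1 := by rw [Fintype.card_fin, h1]
    let k : Fin W.mordellWeilRank := ⟨0, by omega⟩
    -- `B k` is non-torsion: its class in `E(ℚ)/tors` is a member of a linearly independent family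
    have hne := hB.1.ne_zero k
    simp only [Function.comp_apply, ne_eq, QuotientAddGroup.eq_zero_iff,
      AddCommGroup.mem_torsion] at hne
    refine ne_of_eq_of_ne ?_ (hBer W hCM p h5 hord.1 hord.2 Dh hDh (B k) ?_)
    · convert Matrix.det_eq_elem_of_card_eq_one (A := Dh.pairingMatrix B) hcard k
      rfl
    · -- (`convert`: the group law on `E(ℚ)` inside `IsMordellWeilBasis` is elaborated against the
      -- classical `DecidableEq ℚ` instance, the statement against `instDecidableEqRat`)
      convert hne

end Summit.BirchSwinnertonDyer.BirchSwinnertonDyer.Cruxes.PinchPrime.FirstLayerStability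

end
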